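import Summits.HodgeConjecture.HodgeConjecture.Theorems.Ring2AbelianAllAndrePrimitiveHodgeRiemann
import Summits.HodgeConjecture.HodgeConjecture.Theorems.Ring2AbelianAllAndreFibreClassKernelHolds
import HarnessLib

/-!
# Ring 2 · sub-cell AbelianAll (ALL ABELIAN VARIETIES), André axis, part XXIII-b — INJECTIVITY OF `Φ_P` BY HODGE–RIEMANN
# ON THE TOTAL SPACE, and the lift of the COPRIMITIVE part of an invariant algebraic class (part XXI-a §1, re-cut)

HONEST FRAMING (page 1, verbatim): **research route, not a corollary; conditional on HC_CM plus one named
minimal statement.** Cell line: research route conditional on HC_CM; not a corollary; Q11.4-sentence-2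
already refuted in dim ≥ 3. Nothing in this file proves a case of the Hodge conjecture for an abelian variety; `HC_CM`
does not occur in this file; item `Theses.RankFourFaces.CMToAbelian` (stmt-16267) OPEN and not closed here. Seat
`pub-hodge-ring2-ab-andre-2`, gen 15; brief (ii)/(iii).

## Setting (one compact pencil `f : 𝒳 ⟶ S` of abelian `d`-folds, a point `t`, `j = j_t : X_t ↪ 𝒳`, `2r + m = d`)

`K = D.Hη` is the rational hyperplane class of a Kähler–rational datum `D` of the `(d+1)`-fold `𝒳` (so hard Lefschetz AND the
Hodge–Riemann relations hold for `K` on `𝒳`), `κ = j^*K`, `θ = (L_K^{m+1})⁻¹ : H^{2(r+m+1)}(𝒳) → H^{2r}(𝒳)` (hard Lefschetz,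
`2r + (m+1) = d + 1`), `N = θ ∘ j_* ∘ L_κᵐ : H^{2r}(X_t) → H^{2r}(𝒳)`, `Φ = j^* ∘ N`, `pr` = the `κ`-primitive projection of
`H^{2r}(X_t)` (top Lefschetz component), `I = Im j^*`, `P = P^{2r}_κ(X_t)`.

## What is proved (theorems only; no definition, no named fact, no sorry; `HC_CM` absent)

§4 **`eq_zero_of_primitivePart_restrict_lift_eq_zero`** — if `ξ ∈ P ∩ I` and `pr(Φ ξ) = 0` then `ξ = 0`. PROOF: `U := N(P ∩ I)`
is a sub-Hodge structure of the `K`-PRIMITIVE part of `H^{2r}(𝒳)` (`L_K^{m+2}Nξ' = j_*L_κ^{m+1}ξ' = 0`; the diagonal type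
projectors and conjugation pass through `θ`, `j_*` (part XXIII-a) and `L_κᵐ`, and preserve `P ∩ I`); for `ξ' ∈ P ∩ I`,
`L_K^{m+1}(Nξ) ∪ Nξ' = Nξ ∪ j_*L_κᵐξ' = j_*(Φξ ∪ L_κᵐξ') = 0`, since `Φξ` has no primitive part and its coprimitive components pair
to zero with `L_κᵐξ'` (`ξ'` primitive: `L_κ^{m+1}ξ' = 0`). Hodge–Riemann (part XXIII-a §1) gives `Nξ = 0`, whence `j_*L_κᵐξ = 0`,
`L_κᵐξ = 0` (Gysin kernel on invariants, part XII-e `fibreGysinKernelOn_holds`), `ξ = 0` (hard Lefschetz on `X_t`).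
§5 **`primitivePart_top_map_fiberι_mem_map`** — for `W' ∈ N^{p+1}(𝒳)` the top primitive part `pr(j^*W')` lies in
`j^*N^{p+1}(𝒳)`, granted (L)_t(p) and Kleiman's clause `A(X_t, κ)` below `p + 1` (part XXI-a's step with the top component
removed: every coprimitive component `κ ∪ L^{s}ξ_{(a,s+1)}` of `j^*W'` lifts by Deligne's invariance of the primitive parts,
Kleiman's algebraicity of the components and (L)_t(p)).

References: VoisinHodgeI2002 (§6.2.3 Cor. 6.26, §6.3.2 Thm. 6.32, §7.1.2, §7.3.2); VoisinHodgeII2003 (§4.3.1 Thm. 4.18,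
§9.2.4 Prop. 9.20); Kleiman1968AlgebraicCycles (§3); FultonYoungTableaux1997 (App. B §B.1 (6)); Deligne1968 ((2.6.3)).
-/

noncomputable section

set_option linter.dupNamespace false

namespace Summit.HodgeConjecture.HodgeConjecture.Ring2.AbelianAll

open CategoryTheory AlgebraicGeometry
open Literature.AlgebraicGeometry Literature.AlgebraicGeometry.Motives
open Literature.AlgebraicGeometry.HodgeTheory
open Literature.AlgebraicTopology.SingularHomology (singularCohomology cupProduct cupProduct_map)
open Literature.Geometry.Kaehler (lefschetzOperator lefschetzPow HasHardLefschetzProperty)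
/-! ## §4 INJECTIVITY OF `Φ_P` — a `κ`-primitive invariant class `ξ` with `pr_P j_t^* θ j_{t*} L_κᵐ ξ = 0` vanishes -/

section Injectivity

variable {𝒳 S : SchemeOver ℂ} {d : ℕ} {f : 𝒳 ⟶ S}

/-- **HODGE–RIEMANN ON THE TOTAL SPACE MAKES `Φ_P` INJECTIVE.** Let `f : 𝒳 ⟶ S` be a compact pencil of abelian `d`-folds,
`t` a point, `D` a Kähler–rational datum of the `(d+1)`-fold `𝒳` with class `K = D.Hη` whose restriction `κ = j_t^*K` (indeed
every restriction `j_s^*K`) has the hard Lefschetz property on the fibre, `2r + m = d`, and `θ` a right inverse of the hard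
Lefschetz ISOMORPHISM `L_K^{m+1} : H^{2r}(𝒳) → H^{2(r+m+1)}(𝒳)` (so `θ = (L_K^{m+1})⁻¹`). Put
`N = θ ∘ j_{t*} ∘ L_κᵐ : H^{2r}(X_t) → H^{2r}(𝒳)` and `Φ = j_t^* ∘ N`. If `ξ ∈ H^{2r}(X_t)` is `κ`-PRIMITIVE and INVARIANT
(`ξ ∈ Im j_t^*`) and the `κ`-primitive part of `Φ ξ` vanishes, then `ξ = 0`.
PROOF. `U := N(P^{2r} ∩ Im j_t^*) ⊆ H^{2r}(𝒳)` consists of `K`-primitive classes (`L_K^{m+2} N ξ' = L_K j_{t*} L_κᵐ ξ' =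
j_{t*} L_κ^{m+1} ξ' = 0`) and is a sub-Hodge structure (the diagonal type projectors and conjugation pass through `θ`,
`j_{t*}` (§3) and `L_κᵐ`, and preserve `P ∩ Im j^*`). For `ξ' ∈ P ∩ Im j^*`:
`L_K^{m+1}(Nξ) ∪ Nξ' = Nξ ∪ j_{t*}L_κᵐξ' = j_{t*}(Φξ ∪ L_κᵐ ξ')`, and `Φξ ∪ L_κᵐξ' = 0` because `Φ ξ` has no primitive part while
its coprimitive components `L^{s+1}c` give `c ∪ L_κ^{m+s+1}ξ' = 0` (`ξ'` primitive). By §1 (Hodge–Riemann on `P_K^{2r}(𝒳)`)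
`N ξ = 0`; then `j_{t*} L_κᵐ ξ = 0`, so `L_κᵐ ξ = 0` (the Gysin kernel on invariants, part XII-e `fibreGysinKernelOn_holds`) and
`ξ = 0` (hard Lefschetz on `X_t`). [cite: VoisinHodgeI2002, §6.3.2 Thm. 6.32, §6.2.3 Cor. 6.26 and §7.1.2]
[cite: VoisinHodgeII2003, §4.3.1 Thm. 4.18] [cite: FultonYoungTableaux1997, Appendix B §B.1 (6)] -/
theorem eq_zero_of_primitivePart_restrict_lift_eq_zero (hf : IsCompactAbelianPencil f d) (t : ComplexPoints S)
    (D : KaehlerRationalDatum (d + 1) 𝒳)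
    (hK : ∀ s : ComplexPoints S, HasHardLefschetzProperty (complexBetti.map (fiberι f s) 2 D.Hη) d)
    {r m : ℕ} (hrm : 2 * r + m = d)
    (θ : complexBetti 𝒳 (2 * (r + m + 1)) →ₗ[ℂ] complexBetti 𝒳 (2 * r))
    (hθ : ∀ y, lefschetzPowTo D.Hη (m + 1) (2 * r) (2 * (r + m + 1)) (by omega) (θ y) = y)
    {ξ : complexBetti (fiberOver f t) (2 * r)}
    (hξP : ξ ∈ primitiveClasses (complexBetti.map (fiberι f t) 2 D.Hη) d (2 * r))
    (hξI : ξ ∈ LinearMap.range (complexBetti.map (fiberι f t) (2 * r)).hom)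
    (hΦ : primitivePart (complexBetti.map (fiberι f t) 2 D.Hη) d (hK t) (hvan_fiberOver hf t) ⟨(2 * r, 0), by omega⟩
        (complexBetti.map (fiberι f t) (2 * r)
          (θ (fiberGysin hf t (r + m)
            (lefschetzPowTo (complexBetti.map (fiberι f t) 2 D.Hη) m (2 * r) (2 * (r + m)) (by omega) ξ)))) = 0) :
    ξ = 0 := by
  classical
  have h𝒳 := hf.isSmoothProjective_total
  have hXt := hf.isSmoothProjective_fiberOver t
  set K := D.Hη with hKdef
  set κ := complexBetti.map (fiberι f t) 2 K with hκdef
  have hL : Function.Injective (lefschetzPowTo K (m + 1) (2 * r) (2 * (r + m + 1)) (by omega)) :=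
    (bijective_lefschetzPowTo_of_hasHardLefschetz K (isPolarizationClass_Hη h𝒳 D).hasHardLefschetz
      (by omega : 2 * r + (m + 1) = d + 1) _ _).1
  obtain ⟨A⟩ := nonempty_hodgeModel_holds h𝒳
  obtain ⟨B⟩ := nonempty_hodgeModel_holds hXt
  have hK11 : IsOfHodgeType (d + 1) 𝒳 2 1 1 K := D.isOfHodgeType_Hη
  have hκ11 : IsOfHodgeType d (fiberOver f t) 2 1 1 κ := hK11.map_of_isSmoothProjective hXt h𝒳 (fiberι f t)
  have hKreal : conjClass _ 2 K = K := D.conjClass_Hη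
  have hκreal : conjClass _ 2 κ = κ := by
    rw [hκdef]
    change conjClass _ 2 (singularCohomology.map ℂ ℂ _ 2 K) = _
    rw [conjClass_map, hKreal]
  -- the operator `N = θ ∘ j_* ∘ L_κᵐ`, the space `E = P ∩ Im j^*`, and `U = N(E)`
  set Lκ := lefschetzPowTo κ m (2 * r) (2 * (r + m)) (by omega) with hLκ
  let N : complexBetti (fiberOver f t) (2 * r) →ₗ[ℂ] complexBetti 𝒳 (2 * r) := θ ∘ₗ fiberGysin hf t (r + m) ∘ₗ Lκ
  have hN : ∀ x, N x = θ (fiberGysin hf t (r + m) (Lκ x)) := fun _ ↦ rfl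
  let E : Submodule ℂ (complexBetti (fiberOver f t) (2 * r)) :=
    primitiveClasses κ d (2 * r) ⊓ LinearMap.range (complexBetti.map (fiberι f t) (2 * r)).hom
  have hξE : ξ ∈ E := ⟨hξP, hξI⟩
  -- `θ`, `N` pass the diagonal type projectors and conjugation
  have hθT : ∀ (δ : ℤ) (y : complexBetti 𝒳 (2 * (r + m + 1))),
      A.typeProjDiff (2 * r) δ (θ y) = θ (A.typeProjDiff (2 * (r + m + 1)) δ y) := by
    intro δ y
    apply hL
    rw [← typeProjDiff_lefschetzPowTo_of_isOfHodgeType h𝒳 A hK11 δ (m + 1) (2 * r) (2 * (r + m + 1)) (by omega) (θ y),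
      hθ, hθ]
  have hθc : ∀ y : complexBetti 𝒳 (2 * (r + m + 1)),
      conjClass _ (2 * r) (θ y) = θ (conjClass _ (2 * (r + m + 1)) y) := by
    intro y
    apply hL
    rw [← conjClass_lefschetzPowTo_of_conjClass_eq hKreal (m + 1) (2 * r) (2 * (r + m + 1)) (by omega) (θ y), hθ, hθ]
  have hNT : ∀ (δ : ℤ) x, A.typeProjDiff (2 * r) δ (N x) = N (B.typeProjDiff (2 * r) δ x) := by
    intro δ x
    rw [hN, hN, hθT, typeProjDiff_fiberGysin hf t A B, hLκ, typeProjDiff_lefschetzPowTo_of_isOfHodgeType hXt B hκ11]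
  have hNc : ∀ x, conjClass _ (2 * r) (N x) = N (conjClass _ (2 * r) x) := by
    intro x
    rw [hN, hN, hθc, conjClass_fiberGysin hf t, hLκ, conjClass_lefschetzPowTo_of_conjClass_eq hκreal]
  -- `E` is stable under the type projectors of `B` and under conjugation
  have hET : ∀ (δ : ℤ), ∀ x ∈ E, B.typeProjDiff (2 * r) δ x ∈ E := by
    rintro δ x ⟨hxP, ⟨W, hW⟩⟩
    refine ⟨?_, ⟨A.typeProjDiff (2 * r) δ W, ?_⟩⟩
    · have h := map_mem_primitiveClasses_of_commute (κ := κ) (n := d) (fun a ↦ (B.typeProjDiff a δ).toAddMonoidHom)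
        (fun k' l' hkl y ↦ B.lefschetzOperator_typeProjDiff
          (lefschetzOperator_mem_typePiece_of_isOfHodgeType hXt B hκ11) hkl δ y) hxP
      simp only [LinearMap.toAddMonoidHom_coe] at h
      exact h
    · change complexBetti.map (fiberι f t) (2 * r) (A.typeProjDiff (2 * r) δ W) = _
      rw [← typeProjDiff_map_comm h𝒳 hXt (fiberι f t) A B (2 * r) δ W]
      exact congrArg _ hW
  have hEc : ∀ x ∈ E, conjClass _ (2 * r) x ∈ E := by
    rintro x ⟨hxP, ⟨W, hW⟩⟩
    refine ⟨?_, ⟨conjClass _ (2 * r) W, ?_⟩⟩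
    · have h := map_mem_primitiveClasses_of_commute (κ := κ) (n := d) (conjClassHom _)
        (conjClass_lefschetzOperator hκreal) hxP
      simp only [conjClassHom_apply] at h
      exact h
    · change singularCohomology.map ℂ ℂ _ (2 * r) (conjClass _ (2 * r) W) = _
      rw [← conjClass_map]
      exact congrArg _ hW
  -- §1 applied to `U = N(E)`
  have hNξ : N ξ = 0 := by
    refine eq_zero_of_forall_cupProduct_eq_zero_of_subHodge_primitive h𝒳 D A (k := 2 * r) (s := m + 1)
      (m₁ := 2 * (r + m + 1)) (m₂ := 2 * (r + m + 1 + 1)) (U := E.map N) (by omega) (by omega) (by omega) (by omega)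
      ?_ ?_ ?_ (Submodule.mem_map_of_mem hξE) ?_
    · -- `U` is `K`-primitive
      rintro _ ⟨x, hx, rfl⟩
      rw [hN, ← lefschetzPowTo_lefschetzPowTo K 1 (show 2 * r + 2 * (m + 1) = 2 * (r + m + 1) by omega)
        (show 2 * (r + m + 1) + 2 * 1 = 2 * (r + m + 1 + 1) by omega)
        (show 2 * r + 2 * (m + 1 + 1) = 2 * (r + m + 1 + 1) by omega), hθ,
        lefschetzPowTo_fiberGysin hf t K 1 (rfl : r + m + 1 = r + m + 1), hLκ,
        lefschetzPowTo_lefschetzPowTo κ 1 (show 2 * r + 2 * m = 2 * (r + m) by omega)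
          (show 2 * (r + m) + 2 * 1 = 2 * (r + m + 1) by omega) (show 2 * r + 2 * (m + 1) = 2 * (r + m + 1) by omega),
        lefschetzPowTo_eq_zero_of_mem_primitiveClasses hx.1 (show 2 * r + 2 * (m + 1) = 2 * (r + m + 1) by omega)
          (by omega), map_zero]
    · rintro δ _ ⟨x, hx, rfl⟩
      exact ⟨B.typeProjDiff (2 * r) δ x, hET δ x hx, (hNT δ x).symm⟩
    · rintro _ ⟨x, hx, rfl⟩
      exact ⟨conjClass _ (2 * r) x, hEc x hx, (hNc x).symm⟩
    · -- orthogonality: `L^{m+1}(Nξ) ∪ Nξ' = j_*(Φ ξ ∪ L_κᵐ ξ') = 0`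
      rintro _ ⟨x, hx, rfl⟩
      rw [cupProduct_lefschetzPowTo_left K (m + 1) (show 2 * r + 2 * (m + 1) = 2 * (r + m + 1) by omega)
          (show 2 * (r + m + 1) + 2 * r = 2 * (d + 1) by omega) (rfl : 2 * r + 2 * r = 2 * r + 2 * r)
          (show 2 * r + 2 * r + 2 * (m + 1) = 2 * (d + 1) by omega) (N ξ) (N x),
        ← cupProduct_lefschetzPowTo_right K (m + 1) (show 2 * r + 2 * (m + 1) = 2 * (r + m + 1) by omega)
          (show 2 * r + 2 * (r + m + 1) = 2 * (d + 1) by omega) (rfl : 2 * r + 2 * r = 2 * r + 2 * r)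
          (show 2 * r + 2 * r + 2 * (m + 1) = 2 * (d + 1) by omega) (N ξ) (N x),
        hN x, hθ, ← fiberGysin_cupProduct_map_fiberι_of_eq hf t (show r + (r + m) = d by omega) (N ξ) (Lκ x)]
      set φ := complexBetti.map (fiberι f t) (2 * r) (N ξ) with hφ
      suffices h0 : cupProduct (show 2 * r + 2 * (r + m) = 2 * d by omega) φ (Lκ x) = 0 by
        rw [h0, map_zero]
      rw [← sum_lefschetzPowTo_primitivePart (hK t) (hvan_fiberOver hf t) φ, map_sum, LinearMap.sum_apply]
      refine Finset.sum_eq_zero fun P _ ↦ ?_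
      obtain ⟨⟨a, s⟩, hP⟩ := P
      cases s with
      | zero =>
        have ha : a = 2 * r := by omega
        subst ha
        rw [lefschetzPowTo_zero_eq_id, LinearMap.id_apply, hφ, hN, hΦ, LinearMap.map_zero, LinearMap.zero_apply]
      | succ s =>
        dsimp only
        rw [hLκ, cupProduct_lefschetzPowTo_lefschetzPowTo κ (s + 1) m hP
          (show 2 * r + 2 * m = 2 * (r + m) by omega) (show 2 * r + 2 * (r + m) = 2 * d by omega)
          (show 2 * r + 2 * (s + 1 + m) = 2 * r + 2 * (s + 1 + m) from rfl) (by omega),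
          lefschetzPowTo_eq_zero_of_mem_primitiveClasses hx.1 (show 2 * r + 2 * (s + 1 + m) = 2 * r + 2 * (s + 1 + m) from rfl)
            (by omega), map_zero]
  -- from `N ξ = 0` to `ξ = 0`
  have h1 : fiberGysin hf t (r + m) (Lκ ξ) = 0 := by
    have h := congrArg (lefschetzPowTo K (m + 1) (2 * r) (2 * (r + m + 1)) (by omega)) hNξ
    rwa [map_zero, hN, hθ] at h
  obtain ⟨W, hW⟩ := hξI
  have h2 : Lκ ξ = complexBetti.map (fiberι f t) (2 * (r + m)) (lefschetzPowTo K m (2 * r) (2 * (r + m)) (by omega) W) := by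
    rw [map_fiberι_lefschetzPowTo t K m (2 * r) (2 * (r + m)) (by omega) W, hLκ, hκdef]
    exact congrArg _ hW.symm
  have h3 : Lκ ξ = 0 := by
    rw [h2]
    exact fibreGysinKernelOn_holds hf (r + m) t t (lefschetzPowTo K m (2 * r) (2 * (r + m)) (by omega) W)
      (by rw [← h2]; exact h1)
  exact injective_lefschetzPowTo_of_le κ d (hK t) (by omega : 2 * r + m ≤ d) (show 2 * r + 2 * m = 2 * (r + m) by omega)
    (by rw [← hLκ, h3, map_zero])

end Injectivity


/-! ## §5 The coprimitive part of an invariant ALGEBRAIC class of `𝒳` restricted to `X_t` lifts (part XXI-a §1, re-cut) -/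

section Coprimitive

variable {𝒳 S : SchemeOver ℂ} {d : ℕ} {f : 𝒳 ⟶ S}

/-- **The top primitive part of `j_t^* W'`, `W'` algebraic, lies in `j_t^* N^{p+1}(𝒳)`** — granted the lift (L)_t(p) one degree
below and Kleiman's clause `A(X_t, κ)` below `p + 1` (free for abelian fibres, part XXII-d): `j^*W' = Σ_{a+2s=2p+2} Lˢ ξ_{(a,s)}`,
every component with `s ≥ 1` is `κ ∪ (Lˢ⁻¹ξ)` with `Lˢ⁻¹ξ ∈ Im j^* ∩ Nᵖ(X_t) = j^*Nᵖ(𝒳)` (Deligne's invariance of the primitive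
parts, part XII-a; Kleiman's algebraicity of the components, part XVIII-d; (L)_t(p)), hence lies in `j^*N^{p+1}(𝒳)`; so does
`j^*W'` itself; hence so does the top component `ξ_{(2p+2,0)}`. [cite: VoisinHodgeI2002, §6.2.3 Cor. 6.26]
[cite: VoisinHodgeII2003, §4.3.1 Thm. 4.18] [cite: Kleiman1968AlgebraicCycles, §3 (proof of Prop. 3.8)] -/
theorem primitivePart_top_map_fiberι_mem_map (hf : IsCompactAbelianPencil f d) (t : ComplexPoints S)
    {K : complexBetti 𝒳 2} (hKalg : K ∈ algebraicClasses 𝒳 1)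
    (hK : ∀ s : ComplexPoints S, HasHardLefschetzProperty (complexBetti.map (fiberι f s) 2 K) d)
    (hKt : IsPolarizationClass d (fiberOver f t) (complexBetti.map (fiberι f t) 2 K)) {p : ℕ}
    (hA : ∀ (p' r' q' : ℕ), p' < p + 1 → p' + (p + 1) ≤ d → 2 * p' + r' = d → p' + r' = q' →
      Set.SurjOn (lefschetzPow (complexBetti.map (fiberι f t) 2 K) r' (2 * p'))
        (algebraicClasses (fiberOver f t) p' : Set (complexBetti (fiberOver f t) (2 * p')))
        (supportedClasses (fiberOver f t) (2 * p' + 2 * r') q'))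
    (hprev : (algebraicClasses (fiberOver f t) p).comap (complexBetti.map (fiberι f t) (2 * p)).hom ≤
      algebraicClasses 𝒳 p ⊔ LinearMap.ker (complexBetti.map (fiberι f t) (2 * p)).hom)
    {W' : complexBetti 𝒳 (2 * (p + 1))} (hW' : W' ∈ algebraicClasses 𝒳 (p + 1)) :
    primitivePart (complexBetti.map (fiberι f t) 2 K) d (hK t) (hvan_fiberOver hf t) ⟨(2 * (p + 1), 0), by omega⟩
        (complexBetti.map (fiberι f t) (2 * (p + 1)) W') ∈
      (algebraicClasses 𝒳 (p + 1)).map (complexBetti.map (fiberι f t) (2 * (p + 1))).hom := by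
  classical
  have h𝒳 := hf.isSmoothProjective_total
  have hXt := hf.isSmoothProjective_fiberOver t
  set κ := complexBetti.map (fiberι f t) 2 K with hκdef
  set ξ := complexBetti.map (fiberι f t) (2 * (p + 1)) W' with hξdef
  have hξ : ξ ∈ algebraicClasses (fiberOver f t) (p + 1) :=
    algebraicClasses_sup_ker_le_comap hf (p + 1) t (Submodule.mem_sup_left hW')
  have hξmap : ξ ∈ (algebraicClasses 𝒳 (p + 1)).map (complexBetti.map (fiberι f t) (2 * (p + 1))).hom := ⟨W', hW', rfl⟩
  set top : {P : ℕ × ℕ // P.1 + 2 * P.2 = 2 * (p + 1)} := ⟨(2 * (p + 1), 0), by omega⟩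
  -- every NON-top Lefschetz component of `ξ` lies in `j^* N^{p+1}(𝒳)`
  have hcomp : ∀ P : {P : ℕ × ℕ // P.1 + 2 * P.2 = 2 * (p + 1)}, P ≠ top →
      lefschetzPowTo κ P.1.2 P.1.1 (2 * (p + 1)) P.2 (primitivePart κ d (hK t) (hvan_fiberOver hf t) P ξ) ∈
        (algebraicClasses 𝒳 (p + 1)).map (complexBetti.map (fiberι f t) (2 * (p + 1))).hom := by
    intro P hPtop
    have hPalg : primitivePart κ d (hK t) (hvan_fiberOver hf t) P ξ ∈
        supportedClasses (fiberOver f t) P.1.1 (p + 1 - P.1.2) :=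
      primitivePart_mem_supportedClasses_of_surjOn_lt hXt hKt.mem_algebraicClasses (hK t) (hvan_fiberOver hf t)
        (p + 1) hA ξ hξ P
    obtain ⟨B, hB⟩ : ∃ B : complexBetti 𝒳 P.1.1,
        primitivePart κ d (hK t) (hvan_fiberOver hf t) P ξ = complexBetti.map (fiberι f t) P.1.1 B :=
      exists_primitivePart_map_fiberι_eq deligne1968_invariantClass_fromTotalSpace_holds hf K hK W' P t
    obtain ⟨⟨a, s⟩, hP⟩ := P
    dsimp only at hPalg hB ⊢
    cases s with
    | zero =>
      exfalso
      apply hPtop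
      exact Subtype.ext (Prod.ext (by simp only; omega) rfl)
    | succ s =>
      have hm : a + 2 * s = 2 * p := by omega
      have h2 : 2 * p + 2 * 1 = 2 * (p + 1) := by ring
      rw [← lefschetzPowTo_lefschetzPowTo κ 1 hm h2 hP]
      set η := lefschetzPowTo κ s a (2 * p) hm (primitivePart κ d (hK t) (hvan_fiberOver hf t) ⟨(a, s + 1), hP⟩ ξ)
        with hηdef
      have hηalg : η ∈ algebraicClasses (fiberOver f t) p := by
        have h := lefschetzPowTo_mem_supportedClasses hXt hKt.mem_algebraicClasses
          (show 2 * (p + 1 - (s + 1)) = a by omega) hPalg s (2 * p) hm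
        rwa [show p + 1 - (s + 1) + s = p by omega] at h
      have hηB : η = complexBetti.map (fiberι f t) (2 * p) (lefschetzPowTo K s a (2 * p) hm B) := by
        rw [hηdef, hB, map_fiberι_lefschetzPowTo t K s a (2 * p) hm B]
      have hcomap : lefschetzPowTo K s a (2 * p) hm B ∈
          (algebraicClasses (fiberOver f t) p).comap (complexBetti.map (fiberι f t) (2 * p)).hom := by
        rw [Submodule.mem_comap]
        change complexBetti.map (fiberι f t) (2 * p) (lefschetzPowTo K s a (2 * p) hm B) ∈ _
        rw [← hηB]
        exact hηalg
      obtain ⟨a', ha', k, hk, hak⟩ := Submodule.mem_sup.1 (hprev hcomap)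
      rw [LinearMap.mem_ker] at hk
      have hηa' : η = complexBetti.map (fiberι f t) (2 * p) a' := by
        rw [hηB, ← hak, map_add]
        change _ + (complexBetti.map (fiberι f t) (2 * p)).hom k = _
        rw [hk, add_zero]
      refine ⟨lefschetzPowTo K 1 (2 * p) (2 * (p + 1)) h2 a',
        lefschetzPowTo_mem_algebraicClasses h𝒳 hKalg ha' 1 (p + 1) rfl h2, ?_⟩
      change complexBetti.map (fiberι f t) (2 * (p + 1)) (lefschetzPowTo K 1 (2 * p) (2 * (p + 1)) h2 a') = _
      rw [map_fiberι_lefschetzPowTo t K 1 (2 * p) (2 * (p + 1)) h2 a', ← hηa']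
  -- the top component is `ξ` minus the others
  have hsum := sum_lefschetzPowTo_primitivePart (hK t) (hvan_fiberOver hf t) ξ
  rw [← Finset.add_sum_erase _ _ (Finset.mem_univ top)] at hsum
  have h := eq_sub_of_add_eq hsum
  have htopeq : primitivePart κ d (hK t) (hvan_fiberOver hf t) top ξ =
      ξ - ∑ P ∈ Finset.univ.erase top,
        lefschetzPowTo κ P.1.2 P.1.1 (2 * (p + 1)) P.2 (primitivePart κ d (hK t) (hvan_fiberOver hf t) P ξ) := by
    rw [← h]
    exact (lefschetzPowTo_zero_apply κ (2 * (p + 1)) _).symm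
  rw [htopeq]
  refine Submodule.sub_mem _ hξmap (Submodule.sum_mem _ fun P hP ↦ hcomp P (Finset.mem_erase.1 hP).1)

end Coprimitive

end Summit.HodgeConjecture.HodgeConjecture.Ring2.AbelianAll

end
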